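import Literature.NumberTheory.EllipticCurves.BSDRankZeroDensityProofs
import Literature.NumberTheory.EllipticCurves.BSDSelmer
import Literature.NumberTheory.EllipticCurves.LeadingTerm
import HarnessLib

/-!
# `corank_{ℤ_p} Sel_{p^∞}(E/K) ≤ s_p − t_p` WITHOUT Cassels–Tate, and the root-number route
# `#Sel^(p)(E/ℚ) = p ∧ E(ℚ)[p] = 0 ∧ w(E) = −1 ⟹ corank = 1` below `p`-parity only
# (cell `b2b-bsdres`, unit `b2b-bsdres-x10` = X10 / N2 lane, GEN 28; GLUE — theorems only, no
# definition, no named fact of its own, nothing booked)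

HONEST FRAMING (run/shared/lean/b2b/bsd-rank1-residual/, verbatim in every file): the goal of the
cell is to DELETE the COMBINATION-SHAPED residual classes of the Birch–Swinnerton-Dyer formula for
ALL analytic-rank `≤ 1` elliptic curves over `ℚ` — "full BSD formula for every rank `≤ 1` curve in
class `C`" assembled STRICTLY from published theorems — so that the rank-`≤ 1` remainder becomes
exactly the CONSTRUCTION-SHAPED classes, which are TYPED (missing-input `Prop`s), NOT attempted.
This is not "finishing BSD". GLUE for the BSD-DENSITY sprint (binder `h9` of
`bsz_rankLeOne_cRank_of_pieces`; HOME `cells/density/CONVERSION-QUEUE.md` v0 Q2); companion of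
`X10/RankOneOfPSelmerOrderP.lean`, which reaches corank `1` through the Cassels–Tate pairing
(`exists_casselsTate_pairing`, a named fact NOT among the count's binders). This file offers the
alternative through the `p`-PARITY theorem (`p_parity`, Dokchitser–Dokchitser 2010 Thm. 1.4 — the
count's binder `hDD` is its `Sel^(p)` form) and the root number `w(E) = −1`, so that the density
count need not acquire a new named input. Nothing priced or booked; no residual-class mark moves.

## What

* `selmerCorank_add_le_of_natCard_selmerGroup` — for an elliptic curve over a number field `K`, a
  prime `p`, `#Sel^(p)(E/K) = p^s`, `#E(K)[p] = p^t`: **`corank_{ℤ_p} Sel_{p^∞}(E/K) + t ≤ s`**, with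
  NO named fact — the first half of the tree's `exists_selmerRank_eq_add` (`s = rk + t + dim Ш[p]`
  by `natCard_selmerGroup_eq`; `corank = rk + (dim Ш[p^∞][p] − dim Ш[p^∞]/p)` by
  `selmerCorank_eq_mordellWeilRank_add_holds` and the definition of `zpCorank`), stopping before
  the Cassels–Tate evenness step.
* `selmerCorank_eq_one_of_natCard_selmerGroup_eq_of_rootNumber` — over `ℚ`:
  `#Sel^(p)(E) = p ∧ #E(ℚ)[p] = 1 ∧ w(E) = −1 ⟹ corank = 1`, below `p_parity W p` only
  (`(−1)^corank = w(E) = −1` makes the corank odd, and it is `≤ 1`).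
* `rank_one_and_analyticRank_one_of_natCard_selmerGroup_eq_of_rootNumber_of_converse` — plus any
  corank-one `p`-converse at `(E, p)` (parameter) and GZK: `rank E(ℚ) = 1 ∧ ord_{s=1} L(E,s) = 1 ∧
  Ш(E/ℚ)` finite.

References: T. Dokchitser, *Notes on the parity conjecture* §2 [Dokchitser2013ParityNotes];
T. and V. Dokchitser, Ann. of Math. 172 (2010) Thm. 1.4 [DokchitserDokchitserAnnals2010];
J. H. Silverman, *AEC* Thm. X.4.2 [SilvermanAEC2009]; R. Greenberg, LNM 1716 §1 [GreenbergLNM1716].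
-/

set_option autoImplicit false

noncomputable section

open scoped Classical AddSubgroup

open Literature.Algebra.Module Literature.NumberTheory.EllipticCurves WeierstrassCurve

universe u

namespace Summit.BirchSwinnertonDyer.Rank1Residual.X10.SelmerCorankLeOfPSelmer

/-! ### §1. `corank + t_p ≤ s_p`, no named fact -/

/-- **`corank_{ℤ_p} Sel_{p^∞}(E/K) + t_p ≤ s_p`** for an elliptic curve over a number field,
`#Sel^(p)(E/K) = p^s`, `#E(K)[p] = p^t`, with NO named fact: `s = rk + t + dim_{𝔽_p} Ш[p]`
(`natCard_selmerGroup_eq`, Silverman X.4.2(a)) and `corank = rk + (dim Ш[p^∞][p] − dim Ш[p^∞]/p)`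
(`selmerCorank_eq_mordellWeilRank_add_holds`; `zpCorank`), with `Ш[p^∞][p] = Ш[p]`
(`natCard_torsionBy_primaryComponent`). The Cassels–Tate pairing would add that the defect
`s − t − corank` is EVEN (`exists_selmerRank_eq_add`); it is not used here.
[cite: Dokchitser2013ParityNotes, §2 (first display)] [cite: SilvermanAEC2009, Thm. X.4.2 (a)] -/
theorem selmerCorank_add_le_of_natCard_selmerGroup {K : Type u} [Field K] [NumberField K]
    (W : WeierstrassCurve K) [W.IsElliptic] (p : ℕ) [hp : Fact p.Prime] (s t : ℕ)
    (hs : Nat.card (W.selmerGroup p) = p ^ s) (ht : Nat.card (W.toAffine.Point[(p : ℤ)]) = p ^ t) :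
    W.selmerCorank p + t ≤ s := by
  have hp0 : p ≠ 0 := hp.out.ne_zero
  have hp0' : (p : ℤ) ≠ 0 := Int.natCast_ne_zero.mpr hp0
  -- `#Sel^(p) = p^r · #E[p] · #Ш[p]`
  have hSel := W.natCard_selmerGroup_eq hp0
  rw [hs, ht] at hSel
  -- `Ш[p] = Ш[p^∞][p]`, of order `p ^ u`
  set T : AddSubgroup W.sha := AddCommGroup.primaryComponent W.sha p with hT
  haveI hShafin : Finite ((W.sha)[(p : ℤ)]) := W.finite_sha_torsionBy_holds (p : ℤ) hp0'
  have hcard1 : Nat.card (W.sha ⊓ AddSubgroup.torsionBy W.galH1 (p : ℤ) : AddSubgroup W.galH1) =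
      Nat.card ((W.sha)[(p : ℤ)]) :=
    (natCard_torsionBy_addSubgroup W.sha (p : ℤ)).symm
  have hcard2 : Nat.card (T[(p : ℤ)]) = Nat.card ((W.sha)[(p : ℤ)]) :=
    natCard_torsionBy_primaryComponent
  letI : Module (ZMod p) (T[(p : ℤ)]) := AddSubgroup.torsionBy.zmodModule
  haveI hTfin : Finite (T[(p : ℤ)]) :=
    Nat.finite_of_card_ne_zero (by rw [hcard2]; exact Nat.card_pos.ne')
  set u : ℕ := Module.finrank (ZMod p) (T[(p : ℤ)]) with hu
  have hpu : p ^ u = Nat.card (T[(p : ℤ)]) := pow_finrank_eq_natCard _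
  -- `s = r + t + u`
  have hsum : s = W.mordellWeilRank + t + u := by
    apply Nat.pow_right_injective hp.out.two_le
    simp only [pow_add, hSel, hcard1, ← hcard2, ← hpu]
  -- the corank identity, `corank Ш[p^∞] = u − dim Ш[p^∞]/p ≤ u`
  have hcorank : W.selmerCorank p = W.mordellWeilRank + (u - Module.finrank (ZMod p) (ModN T p)) := by
    rw [W.selmerCorank_eq_mordellWeilRank_add_holds p]
    rfl
  rw [hcorank, hsum]
  omega

/-! ### §2. Over `ℚ`: corank `1` from `#Sel^(p) = p`, `E(ℚ)[p] = 0`, `w(E) = −1`, below `p`-parity -/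

/-- **`#Sel^(p)(E/ℚ) = p ∧ #E(ℚ)[p] = 1 ∧ w(E) = −1 ⟹ corank_{ℤ_p} Sel_{p^∞}(E/ℚ) = 1`, below the
`p`-parity theorem only** (`hpar : p_parity W p`, Dokchitser–Dokchitser 2010 Thm. 1.4:
`(−1)^corank = w(E)`): §1 gives `corank ≤ 1`, parity makes it odd. No Cassels–Tate.
[cite: DokchitserDokchitserAnnals2010, Thm. 1.4] [cite: SilvermanAEC2009, Thm. X.4.2 (a)] -/
theorem selmerCorank_eq_one_of_natCard_selmerGroup_eq_of_rootNumber
    (W : WeierstrassCurve ℚ) [W.IsElliptic] (p : ℕ) [Fact p.Prime] (hpar : p_parity W p)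
    (hs : Nat.card (W.selmerGroup p) = p) (ht : Nat.card (W.toAffine.Point[(p : ℤ)]) = 1)
    (hw : W.rootNumber = -1) : W.selmerCorank p = 1 := by
  have hle : W.selmerCorank p + 0 ≤ 1 :=
    selmerCorank_add_le_of_natCard_selmerGroup W p 1 0 (by rw [pow_one]; exact hs)
      (by rw [pow_zero]; convert ht)
  have hpp : (-1 : ℤ) ^ W.selmerCorank p = W.rootNumber := hpar
  rw [hw] at hpp
  have hne0 : W.selmerCorank p ≠ 0 := by
    intro h0
    rw [h0, pow_zero] at hpp
    norm_num at hpp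
  omega

/-- **`#Sel^(p)(E/ℚ) = p ∧ #E(ℚ)[p] = 1 ∧ w(E) = −1 ⟹ rank E(ℚ) = 1 ∧ ord_{s=1} L(E,s) = 1 ∧
Ш(E/ℚ)` finite, below `p`-parity (`hpar`), ANY corank-one `p`-converse at `(E, p)` (`hconv`, a
parameter) and Gross–Zagier–Kolyvagin (`hGZK`)** — the root-number route to the binder `h9`,
using only inputs already among the count's binders (`hDD`-type parity, a converse, GZK).
[cite: DokchitserDokchitserAnnals2010, Thm. 1.4] [cite: Darmon2004, Thm. 3.22 (= 1.14)] -/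
theorem rank_one_and_analyticRank_one_of_natCard_selmerGroup_eq_of_rootNumber_of_converse
    (hGZK : rank_eq_analyticRank_of_analyticRank_le_one)
    (W : WeierstrassCurve ℚ) [W.IsElliptic] (p : ℕ) [Fact p.Prime] (hpar : p_parity W p)
    (hconv : W.selmerCorank p = 1 → W.analyticRank = 1)
    (hs : Nat.card (W.selmerGroup p) = p) (ht : Nat.card (W.toAffine.Point[(p : ℤ)]) = 1)
    (hw : W.rootNumber = -1) :
    W.mordellWeilRank = 1 ∧ W.analyticRank = 1 ∧ Finite W.sha := by
  have han : W.analyticRank = 1 :=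
    hconv (selmerCorank_eq_one_of_natCard_selmerGroup_eq_of_rootNumber W p hpar hs ht hw)
  obtain ⟨hrk, hfin⟩ := hGZK W (by rw [han])
  exact ⟨by rw [hrk, han], han, hfin⟩

end Summit.BirchSwinnertonDyer.Rank1Residual.X10.SelmerCorankLeOfPSelmer

end
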